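import Mathlib
import Summits.Ventures.PercRepro2.Defs
import Summits.Ventures.PercRepro2.Independence
import Summits.Ventures.PercRepro2.Harris
import Summits.Ventures.PercRepro2.Graph
import Summits.Ventures.PercRepro2.RootLeafUCoinGraph

/-!
# (G4-u), the coin class: the shares of `b ∈ K` and `b ∈ L` on `b`-stable events inside `Q`
(blind cell PercRepro2, p4 g15; S3 (G4-u) item (ab); no definitions)

`b` carries exactly the edges `f₁ = {b, a₂}` (weight `p₁`) and `f₂ = {b, u}` (weight `p₂`).  Call an
event `Z` **`b`-stable** when, unless both `b`-edges are open, closing them does not change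
membership (written out: `∀ ω, ¬(ω f₁ ∧ ω f₂) → (ω ∈ Z ↔ ω[f₁, f₂ ↦ closed] ∈ Z)`); every event built
from connections among vertices other than `b` is `b`-stable (`stable_connEvent`, `stable_inter`,
`stable_compl`, `stable_union`).  For a `b`-stable `Z ⊆ {u ↮ a₂}` the two coins are independent of
`Z` given «not both open» (RootLeafUCoinGraph: both open ⟹ `u ↔ a₂`; on `Z`, `b ∈ K ⟺ f₁` open and
`b ∈ L ⟺ f₂` open), so — division-free —

* `prob_inter_bK`: `(1 − p₁p₂)·P(Z, b ∈ K) = p₁(1 − p₂)·P(Z)`,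
* `prob_inter_bL`: `(1 − p₁p₂)·P(Z, b ∈ L) = (1 − p₁)p₂·P(Z)`,
* `prob_eq_off_mul`: `P(Z) = (1 − p₁p₂)·P(Z₀)` with `Z₀ = {ω | ω[f₁, f₂ ↦ closed] ∈ Z}`
  (so every such mass vanishes when `p₁ = p₂ = 1`).

Tools: `prob_inter_eq_mul_of_dependsOn` (events determined by disjoint edge sets are independent),
`prob_inter_openEdge` / `prob_inter_closedEdge` (pinning).
-/

namespace Summit.Ventures.PercRepro2

namespace RootLeafU

namespace Coin

variable {V : Type*} {E : Type*} [Fintype E] [DecidableEq E] {R : Type*} [CommRing R]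

section Stable

variable {ends : E → Sym2 V} {b a₂ u : V} {f₁ f₂ : E}

omit [Fintype E] in
/-- Connections among vertices other than `b` are `b`-stable. -/
lemma stable_connEvent (hf₁ : ends f₁ = s(b, a₂)) (hf₂ : ends f₂ = s(b, u))
    (hb2 : ∀ e, b ∈ ends e → e = f₁ ∨ e = f₂) (hba : b ≠ a₂) (hbu : b ≠ u) {x y : V} (hx : x ≠ b)
    (hy : y ≠ b) : ∀ ω : Config E, ¬ (ω f₁ = true ∧ ω f₂ = true) →
      (ω ∈ connEvent ends x y ↔ Function.update (Function.update ω f₁ false) f₂ false ∈ connEvent ends x y) :=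
  fun _ hnb => conn_iff_off hf₁ hf₂ hb2 hba hbu hnb hx hy

omit [Fintype E] [DecidableEq E] in
/-- Intersections of `b`-stable events are `b`-stable. -/
lemma stable_inter {Z₁ Z₂ : Set (Config E)} {g : Config E → Config E}
    (h1 : ∀ ω : Config E, ¬ (ω f₁ = true ∧ ω f₂ = true) → (ω ∈ Z₁ ↔ g ω ∈ Z₁))
    (h2 : ∀ ω : Config E, ¬ (ω f₁ = true ∧ ω f₂ = true) → (ω ∈ Z₂ ↔ g ω ∈ Z₂)) :
    ∀ ω : Config E, ¬ (ω f₁ = true ∧ ω f₂ = true) → (ω ∈ Z₁ ∩ Z₂ ↔ g ω ∈ Z₁ ∩ Z₂) :=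
  fun ω hnb => and_congr (h1 ω hnb) (h2 ω hnb)

omit [Fintype E] [DecidableEq E] in
/-- Unions of `b`-stable events are `b`-stable. -/
lemma stable_union {Z₁ Z₂ : Set (Config E)} {g : Config E → Config E}
    (h1 : ∀ ω : Config E, ¬ (ω f₁ = true ∧ ω f₂ = true) → (ω ∈ Z₁ ↔ g ω ∈ Z₁))
    (h2 : ∀ ω : Config E, ¬ (ω f₁ = true ∧ ω f₂ = true) → (ω ∈ Z₂ ↔ g ω ∈ Z₂)) :
    ∀ ω : Config E, ¬ (ω f₁ = true ∧ ω f₂ = true) → (ω ∈ Z₁ ∪ Z₂ ↔ g ω ∈ Z₁ ∪ Z₂) :=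
  fun ω hnb => or_congr (h1 ω hnb) (h2 ω hnb)

omit [Fintype E] [DecidableEq E] in
/-- Complements of `b`-stable events are `b`-stable. -/
lemma stable_compl {Z : Set (Config E)} {g : Config E → Config E}
    (h : ∀ ω : Config E, ¬ (ω f₁ = true ∧ ω f₂ = true) → (ω ∈ Z ↔ g ω ∈ Z)) :
    ∀ ω : Config E, ¬ (ω f₁ = true ∧ ω f₂ = true) → (ω ∈ Zᶜ ↔ g ω ∈ Zᶜ) :=
  fun ω hnb => not_congr (h ω hnb)

end Stable

section Coins

variable (p : E → R) {f₁ f₂ : E}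

omit [Fintype E] in
/-- `{ω | ω[f₁, f₂ ↦ closed] ∈ Z}` is determined by the edges other than `f₁, f₂`. -/
lemma dependsOn_off (Z : Set (Config E)) :
    DependsOn (· ∈ {ω : Config E | Function.update (Function.update ω f₁ false) f₂ false ∈ Z})
      (({f₁, f₂} : Set E)ᶜ) := by
  intro ω ω' h
  show (Function.update (Function.update ω f₁ false) f₂ false ∈ Z) =
    (Function.update (Function.update ω' f₁ false) f₂ false ∈ Z)
  rw [off_eq_of_eqOn (fun e h1 h2 => h e (by simp [h1, h2]))]

omit [Fintype E] [DecidableEq E] in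
/-- `{f₁ open, f₂ closed}` is determined by `{f₁, f₂}`. -/
lemma dependsOn_open_closed :
    DependsOn (· ∈ openEdge f₁ ∩ closedEdge f₂) ({f₁, f₂} : Set E) := by
  have := dependsOn_inter (dependsOn_openEdge f₁) (dependsOn_closedEdge f₂)
  rwa [← Set.insert_eq] at this

omit [Fintype E] [DecidableEq E] in
/-- `{f₁ closed, f₂ open}` is determined by `{f₁, f₂}`. -/
lemma dependsOn_closed_open :
    DependsOn (· ∈ closedEdge f₁ ∩ openEdge f₂) ({f₁, f₂} : Set E) := by
  have := dependsOn_inter (dependsOn_closedEdge f₁) (dependsOn_openEdge f₂)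
  rwa [← Set.insert_eq] at this

omit [Fintype E] [DecidableEq E] in
/-- `{f₁ open, f₂ open}` is determined by `{f₁, f₂}`. -/
lemma dependsOn_both :
    DependsOn (· ∈ openEdge f₁ ∩ openEdge f₂) ({f₁, f₂} : Set E) := by
  have := dependsOn_inter (dependsOn_openEdge f₁) (dependsOn_openEdge f₂)
  rwa [← Set.insert_eq] at this

/-- `P(f₁ open, f₂ closed) = p₁(1 − p₂)`. -/
lemma prob_open_closed (hne : f₁ ≠ f₂) :
    prob p (openEdge f₁ ∩ closedEdge f₂) = p f₁ * (1 - p f₂) := by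
  rw [prob_inter_closedEdge, prob_openEdge, Function.update_of_ne hne]
  ring

/-- `P(f₁ closed, f₂ open) = (1 − p₁)p₂`. -/
lemma prob_closed_open (hne : f₁ ≠ f₂) :
    prob p (closedEdge f₁ ∩ openEdge f₂) = (1 - p f₁) * p f₂ := by
  rw [Set.inter_comm, prob_inter_closedEdge, prob_openEdge, Function.update_of_ne hne.symm]

/-- `P(f₁ open, f₂ open) = p₁p₂`. -/
lemma prob_both (hne : f₁ ≠ f₂) :
    prob p (openEdge f₁ ∩ openEdge f₂) = p f₁ * p f₂ := by
  rw [Set.inter_comm, prob_inter_openEdge, prob_openEdge, Function.update_of_ne hne.symm]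

/-- The product rule for `Z₀ ∩ C` with `Z₀` off the coins and `C` on the coins. -/
lemma prob_off_inter_eq_mul (Z C : Set (Config E)) (hC : DependsOn (· ∈ C) ({f₁, f₂} : Set E)) :
    prob p ({ω : Config E | Function.update (Function.update ω f₁ false) f₂ false ∈ Z} ∩ C) =
      prob p {ω : Config E | Function.update (Function.update ω f₁ false) f₂ false ∈ Z} * prob p C :=
  prob_inter_eq_mul_of_dependsOn p disjoint_compl_left (dependsOn_off Z) hC

end Coins

section Shares

variable (p : E → R) {ends : E → Sym2 V} {b a₂ u : V} {f₁ f₂ : E}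

omit [Fintype E] in
/-- A `b`-stable event inside `{u ↮ a₂}` is its off-coin copy intersected with «not both open». -/
lemma eq_off_inter_compl (hf₁ : ends f₁ = s(b, a₂)) (hf₂ : ends f₂ = s(b, u)) {Z : Set (Config E)}
    (hZ : ∀ ω : Config E, ¬ (ω f₁ = true ∧ ω f₂ = true) →
      (ω ∈ Z ↔ Function.update (Function.update ω f₁ false) f₂ false ∈ Z))
    (hZQ : ∀ ω ∈ Z, ¬ Conn ends ω u a₂) :
    Z = {ω : Config E | Function.update (Function.update ω f₁ false) f₂ false ∈ Z} ∩
      (openEdge f₁ ∩ openEdge f₂)ᶜ := by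
  ext ω
  simp only [Set.mem_inter_iff, Set.mem_setOf_eq, Set.mem_compl_iff, mem_openEdge]
  constructor
  · intro hω
    have hnb : ¬ (ω f₁ = true ∧ ω f₂ = true) := fun h => hZQ ω hω (conn_u_a2_of_both hf₁ hf₂ h)
    exact ⟨(hZ ω hnb).1 hω, hnb⟩
  · rintro ⟨h0, hnb⟩
    exact (hZ ω hnb).2 h0

omit [Fintype E] in
/-- On a `b`-stable event inside `{u ↮ a₂}`, `b ∈ K` is «`f₁` open, `f₂` closed». -/
lemma inter_bK_eq (hf₁ : ends f₁ = s(b, a₂)) (hf₂ : ends f₂ = s(b, u))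
    (hb2 : ∀ e, b ∈ ends e → e = f₁ ∨ e = f₂) (hba : b ≠ a₂) (hbu : b ≠ u) {Z : Set (Config E)}
    (hZ : ∀ ω : Config E, ¬ (ω f₁ = true ∧ ω f₂ = true) →
      (ω ∈ Z ↔ Function.update (Function.update ω f₁ false) f₂ false ∈ Z))
    (hZQ : ∀ ω ∈ Z, ¬ Conn ends ω u a₂) :
    Z ∩ connEvent ends a₂ b = {ω : Config E | Function.update (Function.update ω f₁ false) f₂ false ∈ Z} ∩
      (openEdge f₁ ∩ closedEdge f₂) := by
  ext ω
  simp only [Set.mem_inter_iff, Set.mem_setOf_eq, mem_openEdge, mem_closedEdge, mem_connEvent]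
  constructor
  · rintro ⟨hω, hc⟩
    have hnb : ¬ (ω f₁ = true ∧ ω f₂ = true) := fun h => hZQ ω hω (conn_u_a2_of_both hf₁ hf₂ h)
    refine ⟨(hZ ω hnb).1 hω, ?_⟩
    rcases (conn_b_iff hf₁ hf₂ hb2 hba hbu hnb hba.symm).1 hc with ⟨h1, _⟩ | ⟨h2, hc'⟩
    · refine ⟨h1, ?_⟩
      cases h : ω f₂
      · rfl
      · exact absurd ⟨h1, h⟩ hnb
    · exact absurd (conn_symm (conn_mono (off_le f₁ f₂ ω) hc')) (hZQ ω hω)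
  · rintro ⟨h0, h1, h2⟩
    have hnb : ¬ (ω f₁ = true ∧ ω f₂ = true) := fun h => by rw [h2] at h; exact Bool.false_ne_true h.2
    exact ⟨(hZ ω hnb).2 h0, conn_of_openAdj ⟨f₁, h1, by rw [hf₁, Sym2.eq_swap]⟩⟩

omit [Fintype E] in
/-- On a `b`-stable event inside `{u ↮ a₂}`, `b ∈ L` is «`f₁` closed, `f₂` open». -/
lemma inter_bL_eq (hf₁ : ends f₁ = s(b, a₂)) (hf₂ : ends f₂ = s(b, u))
    (hb2 : ∀ e, b ∈ ends e → e = f₁ ∨ e = f₂) (hba : b ≠ a₂) (hbu : b ≠ u) {Z : Set (Config E)}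
    (hZ : ∀ ω : Config E, ¬ (ω f₁ = true ∧ ω f₂ = true) →
      (ω ∈ Z ↔ Function.update (Function.update ω f₁ false) f₂ false ∈ Z))
    (hZQ : ∀ ω ∈ Z, ¬ Conn ends ω u a₂) :
    Z ∩ connEvent ends u b = {ω : Config E | Function.update (Function.update ω f₁ false) f₂ false ∈ Z} ∩
      (closedEdge f₁ ∩ openEdge f₂) := by
  ext ω
  simp only [Set.mem_inter_iff, Set.mem_setOf_eq, mem_openEdge, mem_closedEdge, mem_connEvent]
  constructor
  · rintro ⟨hω, hc⟩
    have hnb : ¬ (ω f₁ = true ∧ ω f₂ = true) := fun h => hZQ ω hω (conn_u_a2_of_both hf₁ hf₂ h)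
    refine ⟨(hZ ω hnb).1 hω, ?_⟩
    rcases (conn_b_iff hf₁ hf₂ hb2 hba hbu hnb hbu.symm).1 hc with ⟨h1, hc'⟩ | ⟨h2, _⟩
    · exact absurd (conn_mono (off_le f₁ f₂ ω) hc') (hZQ ω hω)
    · refine ⟨?_, h2⟩
      cases h : ω f₁
      · rfl
      · exact absurd ⟨h, h2⟩ hnb
  · rintro ⟨h0, h1, h2⟩
    have hnb : ¬ (ω f₁ = true ∧ ω f₂ = true) := fun h => by rw [h1] at h; exact Bool.false_ne_true h.1
    exact ⟨(hZ ω hnb).2 h0, conn_of_openAdj ⟨f₂, h2, by rw [hf₂, Sym2.eq_swap]⟩⟩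

/-- **The mass of a `b`-stable event inside `Q`**: `P(Z) = (1 − p₁p₂)·P(Z₀)`. -/
theorem prob_eq_off_mul (hf₁ : ends f₁ = s(b, a₂)) (hf₂ : ends f₂ = s(b, u)) (hne : f₁ ≠ f₂)
    {Z : Set (Config E)}
    (hZ : ∀ ω : Config E, ¬ (ω f₁ = true ∧ ω f₂ = true) →
      (ω ∈ Z ↔ Function.update (Function.update ω f₁ false) f₂ false ∈ Z))
    (hZQ : ∀ ω ∈ Z, ¬ Conn ends ω u a₂) :
    prob p Z = (1 - p f₁ * p f₂) *
      prob p {ω : Config E | Function.update (Function.update ω f₁ false) f₂ false ∈ Z} := by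
  have e := eq_off_inter_compl hf₁ hf₂ hZ hZQ
  have h1 := prob_inter_add_prob_inter_compl p
    {ω : Config E | Function.update (Function.update ω f₁ false) f₂ false ∈ Z} (openEdge f₁ ∩ openEdge f₂)
  rw [prob_off_inter_eq_mul p Z _ dependsOn_both, prob_both p hne] at h1
  conv_lhs => rw [e]
  linear_combination h1

/-- **The `b ∈ K` share** on a `b`-stable event inside `Q`: `(1 − p₁p₂)·P(Z, b ∈ K) = p₁(1 − p₂)·P(Z)`. -/
theorem prob_inter_bK (hf₁ : ends f₁ = s(b, a₂)) (hf₂ : ends f₂ = s(b, u))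
    (hb2 : ∀ e, b ∈ ends e → e = f₁ ∨ e = f₂) (hba : b ≠ a₂) (hbu : b ≠ u) (hne : f₁ ≠ f₂)
    {Z : Set (Config E)}
    (hZ : ∀ ω : Config E, ¬ (ω f₁ = true ∧ ω f₂ = true) →
      (ω ∈ Z ↔ Function.update (Function.update ω f₁ false) f₂ false ∈ Z))
    (hZQ : ∀ ω ∈ Z, ¬ Conn ends ω u a₂) :
    (1 - p f₁ * p f₂) * prob p (Z ∩ connEvent ends a₂ b) = p f₁ * (1 - p f₂) * prob p Z := by
  rw [inter_bK_eq hf₁ hf₂ hb2 hba hbu hZ hZQ, prob_off_inter_eq_mul p Z _ dependsOn_open_closed,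
    prob_open_closed p hne, prob_eq_off_mul p hf₁ hf₂ hne hZ hZQ]
  ring

/-- **The `b ∈ L` share** on a `b`-stable event inside `Q`: `(1 − p₁p₂)·P(Z, b ∈ L) = (1 − p₁)p₂·P(Z)`. -/
theorem prob_inter_bL (hf₁ : ends f₁ = s(b, a₂)) (hf₂ : ends f₂ = s(b, u))
    (hb2 : ∀ e, b ∈ ends e → e = f₁ ∨ e = f₂) (hba : b ≠ a₂) (hbu : b ≠ u) (hne : f₁ ≠ f₂)
    {Z : Set (Config E)}
    (hZ : ∀ ω : Config E, ¬ (ω f₁ = true ∧ ω f₂ = true) →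
      (ω ∈ Z ↔ Function.update (Function.update ω f₁ false) f₂ false ∈ Z))
    (hZQ : ∀ ω ∈ Z, ¬ Conn ends ω u a₂) :
    (1 - p f₁ * p f₂) * prob p (Z ∩ connEvent ends u b) = (1 - p f₁) * p f₂ * prob p Z := by
  rw [inter_bL_eq hf₁ hf₂ hb2 hba hbu hZ hZQ, prob_off_inter_eq_mul p Z _ dependsOn_closed_open,
    prob_closed_open p hne, prob_eq_off_mul p hf₁ hf₂ hne hZ hZQ]
  ring

end Shares

end Coin

end RootLeafU

end Summit.Ventures.PercRepro2
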